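import Literature.MathematicalPhysics.QuantumFieldTheory.Balaban1983to89.B1Eq346DetFactorization

/-!
# `Balaban1983to89.B2Ineq2103LogDet` — [Balaban1982Higgs2] (2.103) p. 578 and (3.19)–(3.20) p. 587: the UPPER bounds
`[det(I − K)]^{−1/2} ≦ exp[Σ_{l≤n̄}(1/2l)Tr K^l + O(1)Tr K^{n̄+1}]`, `≦ exp O(‖K‖)|Λ|` complementing the lower bound (I.3.47) —
PROVED for real symmetric matrices with EXPLICIT `O(1)` constants (spectral theorem; the factorization algebra is the sibling
`…B1Eq346DetFactorization`)

statement-level skeleton of published theorems with citation tags; proofs where landed; nothing here is a claim about the Yang–Mills mass gap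

CITATION HEADER.  T. Bałaban, *(Higgs)₂,₃ quantum fields in a finite volume. II. An upper bound*, Commun. Math. Phys. **86**
(1982) 555–594, doi:10.1007/bf01214890 [Balaban1982Higgs2] (cell paper B2; PDF held `paper:balaban1982-cmp86-higgs23-ii`,
journal page = PDF page + 554; pp. 577, 578, 586, 587 READ AS IMAGES on the ×2 renders `run/shared/lean/pub/pub-balaban/
b2b-balaban-ref1/pages/1982-cmp86-higgs23-II/…-p023, p024, p032, p033-x2.png`).  Unit `lit-balaban-p04` gen 3 (Phase-2 proof
seat; HOME `run/shared/lean/pub/lit-balaban/`); SKELETON rows **B2.Eq2.103** (member (2.103); members (2.100)–(2.102) are in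
the sibling) and **B2.Eq3.20** (members (3.19)–(3.20); (3.18) in the sibling).  The scalar engine of the opposite (lower)
bound, *"log(1 + λ) ≦ λ − λ²/2 + … + (−1)^{n−1}λⁿ/n"* (I p. 620), is `B1LowerBound.log_one_add_le_logTaylor` (r14); the lower
bound (I.3.47) itself is `B1Sect3Statements.ineq347_of_posDef` (r12) — neither is restated.  Referee ref-4; owners r02/r14.

WHAT IS PRINTED (verbatim).  **p. 578** [PDF 24]: *"The inequality −½log(1 − λ) ≦ ½λ + ¼λ² + ⅙λ³ + … + (1/2n)λⁿ + O(1)λ^{n+1}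
holding for n odd and λ satisfying γ₀/γ₁ ≦ 1 − λ ≦ γ₁/γ₀ implies the inequality [det(I − (C(…))^{1/2}W^{(j)}(C(…))^{1/2})]^{−1/2}
≦ exp[Σ_{l=1}^{n̄} (1/2l) Tr(C(B^j(Λ₂^{(j)}),B̃)W^{(j)})^l + O(1)Tr(C(B^j(Λ₂^{(j)}),B̃)W^{(j)})^{n̄+1}]. (2.103)"*
**p. 587** [PDF 33]: *"and the operator under the second determinant satisfies ‖G′_k^{−1/2}H′_kG′_k^{−1/2}‖ ≦ γ₁⁻¹μ₀²(Lᵏε)⁻²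
O(1)exp(−δ₁r(Lᵏε)) ≦ O(1)(Lᵏε)^κ, κ arbitrary. (3.19) Hence this determinant can be estimated as follows
[det(I − G′_k^{−1/2}H′_kG′_k^{−1/2})]^{−1/2} ≦ exp[½Tr(G′_k^{−1/2}H′_kG′_k^{−1/2}) + O(1)Tr(G′_k^{−1/2}H′_kG′_k^{−1/2})²]
≦ exp[½‖G′_k^{−1/2}H′_kG′_k^{−1/2}‖·Tr(I↾Λ₅^{(k)}) + O(1)‖G′_k^{−1/2}H′_kG′_k^{−1/2}‖²Tr(I↾Λ₅^{(k)})] ≦ exp O((Lᵏε)^κ)|Λ₅^{(k)}|,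
(3.20) where an analog of the inequality (2.103) was used."*  (p. 586: *"Hence for Lᵏε sufficiently small, the operators
G′_k − H′_k and G″_k − H″_k are positive and satisfy the inequalities (3.11) with ½γ₁ instead of γ₁."*)

THE MATHEMATICS (print gives no proof of the scalar inequality).  `f(λ) := −½log(1−λ) − Σ_{l≤n}λ^l/(2l)` has `f(0) = 0`,
`f′(λ) = ½λⁿ/(1−λ)` (geometric sum); for `n` odd, `f′ ≥ 0` on `[0,1)` and `f′ ≤ 0` on `(−∞,0]`, whence for `0 < c ≤ 1 − λ`,
`c ≤ 1`: `f(λ) ≤ λ^{n+1}/(2(n+1)c)` on BOTH sides of `0` (on the left already with `c = 1`).  So the printed `O(1)` may be taken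
`= γ₁/(2(n+1)γ₀)` and only the LOWER half `γ₀/γ₁ ≦ 1 − λ` of the printed range is needed.  Matrix forms follow eigenvalue-wise
(`Tr K^m = Σ_i λ_i^m`, `det(I − K) = Π_i(1 − λ_i)`, r12's `B1Sect3Statements.trace_pow_eq_sum_eigenvalues` /
`det_one_sub_eq_prod_eigenvalues`); `‖K‖ ≦ κ` for symmetric `K` is the Loewner sandwich `−κI ≦ K ≦ κI`; `Tr(I↾Λ) = |Λ|` =
`Fintype.card ι`.  THEOREMS ONLY (no `def`, no new `Prop` fact); axioms standard.

WHAT THIS MODULE PROVES.  §1 **(2.103) scalar** `neg_half_log_one_sub_le` (explicit `O(1) = 1/(2(n+1)c)`).  §2 **(2.103) matrix**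
`ineq2103` (for symmetric `K` with `cI ≦ I − K`) and `ineq2103_printed` (the printed `Tr(C₀W)^l` form for `C₁⁻¹ = C₀⁻¹ − W`,
`γ₀I ≦ C₀, C₁ ≦ γ₁I`, using the sibling's (2.102)).  §3 **(3.19)** `ineq319` (`‖G′^{−1/2}H′G′^{−1/2}‖ ≦ h/g` in Loewner form from
`G′ ≧ gI`, `−hI ≦ H′ ≦ hI` — the mechanism; the constants `γ₁⁻¹μ₀²(Lᵏε)⁻²O(1)e^{−δ₁r}` are the inputs (3.11)/(3.12)), `posDef_sub319`
(`G′ − H′ ≻ 0` for `h < g`).  §4 **(3.20)** `trace_le320`, `ineq320` (the three printed `≦` with `O(1) = 1/(4(1−κ))`, final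
constant `1`: `det(I−K)^{−1/2} ≦ exp(κ|Λ|)` for `‖K‖ ≦ κ ≦ ½`), `ineq318_320` (composite with (3.18): `[det(G′−H′)]^{−1/2} ≦
(det G′)^{−1/2}exp((h/g)|Λ|)`).
-/

open scoped BigOperators MatrixOrder
open Finset Matrix

namespace Literature.MathematicalPhysics.QuantumFieldTheory.Balaban1983to89.B2Ineq2103LogDet

open B1Eq346DetFactorization

variable {ι : Type*} [Fintype ι] [DecidableEq ι]

/-! ## §1 (2.103) p. 578, the scalar inequality with an explicit constant -/

/-- **(2.103)** p. 578, scalar form: *"−½log(1 − λ) ≦ ½λ + ¼λ² + ⅙λ³ + … + (1/2n)λⁿ + O(1)λ^{n+1} holding for n odd and λ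
satisfying γ₀/γ₁ ≦ 1 − λ ≦ γ₁/γ₀"* — PROVED for `n` odd and `c ≤ 1 − λ` (`0 < c ≤ 1`, ↤ `γ₀/γ₁`) with `O(1) = 1/(2(n+1)c)`.
[cite: Balaban1982Higgs2, (2.103) p.578] -/
theorem neg_half_log_one_sub_le {n : ℕ} (hn : Odd n) {c μ : ℝ} (hc : 0 < c) (hc1 : c ≤ 1) (hμ : c ≤ 1 - μ) :
    -(1 / 2) * Real.log (1 - μ) ≤
      (∑ j ∈ range n, (1 / (2 * ((j : ℝ) + 1))) * μ ^ (j + 1)) + 1 / (2 * ((n : ℝ) + 1) * c) * μ ^ (n + 1) := by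
  -- g := (right side) + ½ log(1 − ·); claim g μ ≥ g 0 = 0
  set g : ℝ → ℝ := fun y => (∑ j ∈ range n, (1 / (2 * ((j : ℝ) + 1))) * y ^ (j + 1)) +
      1 / (2 * ((n : ℝ) + 1) * c) * y ^ (n + 1) + (1 / 2) * Real.log (1 - y) with hg
  have hc0 : c ≠ 0 := hc.ne'
  -- the derivative in closed form: g′(y) = yⁿ(1 − y − c) / (2c(1 − y))
  have hderiv : ∀ y : ℝ, y < 1 → HasDerivAt g (y ^ n * (1 - y - c) / (2 * c * (1 - y))) y := by
    intro y hy
    have hy0 : 1 - y ≠ 0 := by linarith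
    have hy1 : y - 1 ≠ 0 := by linarith
    have hS : HasDerivAt (fun y : ℝ => ∑ j ∈ range n, (1 / (2 * ((j : ℝ) + 1))) * y ^ (j + 1))
        (∑ j ∈ range n, (1 / 2 : ℝ) * y ^ j) y := by
      have h : ∀ j ∈ range n, HasDerivAt (fun y : ℝ => (1 / (2 * ((j : ℝ) + 1))) * y ^ (j + 1)) ((1 / 2) * y ^ j) y := by
        intro j _
        have h1 := (hasDerivAt_pow (j + 1) y).const_mul (1 / (2 * ((j : ℝ) + 1)))
        have e : (1 / (2 * ((j : ℝ) + 1))) * (((j + 1 : ℕ) : ℝ) * y ^ (j + 1 - 1)) = (1 / 2) * y ^ j := by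
          rw [Nat.add_sub_cancel]; push_cast; field_simp
        rwa [e] at h1
      exact HasDerivAt.fun_sum h
    have hR : HasDerivAt (fun y : ℝ => 1 / (2 * ((n : ℝ) + 1) * c) * y ^ (n + 1)) (1 / (2 * c) * y ^ n) y := by
      have h1 := (hasDerivAt_pow (n + 1) y).const_mul (1 / (2 * ((n : ℝ) + 1) * c))
      have e : 1 / (2 * ((n : ℝ) + 1) * c) * (((n + 1 : ℕ) : ℝ) * y ^ (n + 1 - 1)) = 1 / (2 * c) * y ^ n := by
        rw [Nat.add_sub_cancel]; push_cast; field_simp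
      rwa [e] at h1
    have hL : HasDerivAt (fun y : ℝ => (1 / 2) * Real.log (1 - y)) ((1 / 2) * ((1 - y)⁻¹ * (-1))) y :=
      ((Real.hasDerivAt_log hy0).comp y ((hasDerivAt_id y).const_sub 1)).const_mul (1 / 2)
    have hsum := (hS.add hR).add hL
    refine hsum.congr_deriv ?_
    rw [← mul_sum, geom_sum_eq (by linarith : y ≠ 1)]
    field_simp
    ring
  have hcont : ∀ y : ℝ, y < 1 → ContinuousAt g y := fun y hy => (hderiv y hy).continuousAt
  have hg0 : g 0 = 0 := by
    simp [hg]
  have hdiffOn : ∀ s : Set ℝ, (∀ y ∈ s, y < 1) → DifferentiableOn ℝ g s := fun s hs y hy =>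
    (hderiv y (hs y hy)).differentiableAt.differentiableWithinAt
  have hcontOn : ∀ s : Set ℝ, (∀ y ∈ s, y < 1) → ContinuousOn g s := fun s hs y hy =>
    (hcont y (hs y hy)).continuousWithinAt
  suffices h : 0 ≤ g μ by
    have : g μ = (∑ j ∈ range n, (1 / (2 * ((j : ℝ) + 1))) * μ ^ (j + 1)) +
        1 / (2 * ((n : ℝ) + 1) * c) * μ ^ (n + 1) + (1 / 2) * Real.log (1 - μ) := rfl
    linarith
  rcases le_or_gt 0 μ with hμ0 | hμ0
  · -- on [0, 1 − c] the derivative is ≥ 0: g monotone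
    have hmono : MonotoneOn g (Set.Icc 0 (1 - c)) := by
      refine monotoneOn_of_deriv_nonneg (convex_Icc 0 (1 - c)) (hcontOn _ fun y hy => ?_) ?_ ?_
      · exact lt_of_le_of_lt hy.2 (by linarith)
      · rw [interior_Icc]
        exact hdiffOn _ fun y hy => lt_trans hy.2 (by linarith)
      · intro y hy
        rw [interior_Icc] at hy
        rw [(hderiv y (lt_trans hy.2 (by linarith))).deriv]
        have h1 : 0 ≤ y ^ n := pow_nonneg hy.1.le n
        have h2 : 0 ≤ 1 - y - c := by linarith [hy.2]
        have h3 : 0 < 2 * c * (1 - y) := by nlinarith [hy.2]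
        positivity
    have := hmono ⟨le_rfl, by linarith⟩ ⟨hμ0, by linarith⟩ hμ0
    rwa [hg0] at this
  · -- on (−∞, 0] the derivative is ≤ 0 (n odd): g antitone
    have hanti : AntitoneOn g (Set.Iic 0) := by
      refine antitoneOn_of_deriv_nonpos (convex_Iic 0) (hcontOn _ fun y hy => ?_) ?_ ?_
      · exact lt_of_le_of_lt (Set.mem_Iic.1 hy) one_pos
      · rw [interior_Iic]
        exact hdiffOn _ fun y hy => lt_trans (Set.mem_Iio.1 hy) one_pos
      · intro y hy
        rw [interior_Iic] at hy
        have hy' : y < 0 := hy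
        rw [(hderiv y (by linarith)).deriv]
        have h1 : y ^ n ≤ 0 := (Odd.pow_nonpos_iff hn).2 hy'.le
        have h2 : 0 ≤ 1 - y - c := by linarith
        have h3 : 0 < 2 * c * (1 - y) := by nlinarith
        exact div_nonpos_of_nonpos_of_nonneg (mul_nonpos_of_nonpos_of_nonneg h1 h2) h3.le
    have := hanti (Set.mem_Iic.2 hμ0.le) (Set.mem_Iic.2 le_rfl) hμ0.le
    rwa [hg0] at this

/-! ## §2 (2.103) p. 578, the determinant–trace inequality -/

/-- **(2.103)** p. 578, matrix form over one symmetric `K` (↤ `C^{1/2}W^{(j)}C^{1/2}`) with `cI ≦ I − K` (`0 < c ≤ 1`, ↤ `γ₀/γ₁`,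
the lower half of (2.102)) and `n` odd: `[det(I − K)]^{−1/2} ≦ exp[Σ_{l=1}^{n}(1/2l)Tr K^l + (1/(2(n+1)c))Tr K^{n+1}]`.
[cite: Balaban1982Higgs2, (2.103) p.578] -/
theorem ineq2103 {K : Matrix ι ι ℝ} (hK : K.IsHermitian) {c : ℝ} (hc : 0 < c) (hc1 : c ≤ 1)
    (hcK : ((1 - c) • (1 : Matrix ι ι ℝ) - K).PosSemidef) {n : ℕ} (hn : Odd n) :
    (1 - K).det ^ (-(1 / 2 : ℝ)) ≤ Real.exp ((∑ j ∈ range n, (1 / (2 * ((j : ℝ) + 1))) * (K ^ (j + 1)).trace) +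
        1 / (2 * ((n : ℝ) + 1) * c) * (K ^ (n + 1)).trace) := by
  have hle := eigenvalues_le_of_posSemidef hK hcK
  have hdet := B1Sect3Statements.det_one_sub_eq_prod_eigenvalues hK
  have hpos : ∀ i, 0 < 1 - hK.eigenvalues i := fun i => by linarith [hle i]
  have hdetpos : 0 < (1 - K).det := by rw [hdet]; exact prod_pos fun i _ => hpos i
  have hsc : ∀ i, -(1 / 2) * Real.log (1 - hK.eigenvalues i) ≤
      (∑ j ∈ range n, (1 / (2 * ((j : ℝ) + 1))) * hK.eigenvalues i ^ (j + 1)) +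
        1 / (2 * ((n : ℝ) + 1) * c) * hK.eigenvalues i ^ (n + 1) :=
    fun i => neg_half_log_one_sub_le hn hc hc1 (by linarith [hle i])
  have hexp : (∑ j ∈ range n, (1 / (2 * ((j : ℝ) + 1))) * (K ^ (j + 1)).trace) +
        1 / (2 * ((n : ℝ) + 1) * c) * (K ^ (n + 1)).trace
      = ∑ i, ((∑ j ∈ range n, (1 / (2 * ((j : ℝ) + 1))) * hK.eigenvalues i ^ (j + 1)) +
          1 / (2 * ((n : ℝ) + 1) * c) * hK.eigenvalues i ^ (n + 1)) := by
    rw [sum_add_distrib]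
    simp_rw [B1Sect3Statements.trace_pow_eq_sum_eigenvalues hK, mul_sum]
    rw [sum_comm]
  have hl : Real.log (∏ i, (1 - hK.eigenvalues i)) * (-(1 / 2 : ℝ)) =
      ∑ i, (-(1 / 2) * Real.log (1 - hK.eigenvalues i)) := by
    rw [Real.log_prod fun i _ => (hpos i).ne', sum_mul]
    exact sum_congr rfl fun i _ => by ring
  rw [hexp, Real.rpow_def_of_pos hdetpos, Real.exp_le_exp, hdet, hl]
  exact sum_le_sum fun i _ => hsc i

/-- **(2.103)** p. 578 AS PRINTED (trace form `Tr(C₀W)^l`): for `C₀, C₁ ≻ 0` with `C₁⁻¹ = C₀⁻¹ − W` ((2.99)), the bounds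
`γ₀I ≦ C₀, C₁ ≦ γ₁I` of Proposition I.2.3 (`0 < γ₀ ≤ γ₁`) and `n` odd (↤ n̄):
`[det(I − C₀^{1/2}WC₀^{1/2})]^{−1/2} ≦ exp[Σ_{l=1}^{n}(1/2l)Tr(C₀W)^l + O(1)Tr(C₀W)^{n+1}]` with `O(1) = γ₁/(2(n+1)γ₀)` — via
(2.102) (`eq2102`, `ineq2102`), cyclicity and `ineq2103`. [cite: Balaban1982Higgs2, (2.103) p.578] -/
theorem ineq2103_printed {C₀ C₁ W : Matrix ι ι ℝ} (hC₀ : C₀.PosDef) (hC₁ : C₁.PosDef) (hW : C₁⁻¹ = C₀⁻¹ - W)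
    {γ₀ γ₁ : ℝ} (hγ₀ : 0 < γ₀) (hγ : γ₀ ≤ γ₁)
    (h₀l : (C₀ - γ₀ • (1 : Matrix ι ι ℝ)).PosSemidef) (h₀u : (γ₁ • (1 : Matrix ι ι ℝ) - C₀).PosSemidef)
    (h₁l : (C₁ - γ₀ • (1 : Matrix ι ι ℝ)).PosSemidef) (h₁u : (γ₁ • (1 : Matrix ι ι ℝ) - C₁).PosSemidef)
    {n : ℕ} (hn : Odd n) :
    (1 - CFC.sqrt C₀ * W * CFC.sqrt C₀).det ^ (-(1 / 2 : ℝ)) ≤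
      Real.exp ((∑ j ∈ range n, (1 / (2 * ((j : ℝ) + 1))) * ((C₀ * W) ^ (j + 1)).trace) +
        γ₁ / (2 * ((n : ℝ) + 1) * γ₀) * ((C₀ * W) ^ (n + 1)).trace) := by
  have hγ₁ : 0 < γ₁ := lt_of_lt_of_le hγ₀ hγ
  set c : ℝ := γ₀ / γ₁ with hcdef
  have hc : 0 < c := div_pos hγ₀ hγ₁
  have hc1 : c ≤ 1 := (div_le_one hγ₁).2 hγ
  have hKh := (isHermitian_K346 hC₀ hC₁ hW).2
  have hcK : ((1 - c) • (1 : Matrix ι ι ℝ) - CFC.sqrt C₀ * W * CFC.sqrt C₀).PosSemidef := by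
    have h := (ineq2102 hC₀ hC₁ hγ₀ hγ₁ h₀l h₀u h₁l h₁u).1
    rw [← eq2102 hC₀ hW] at h
    have e : (1 - c) • (1 : Matrix ι ι ℝ) - CFC.sqrt C₀ * W * CFC.sqrt C₀ =
        1 - CFC.sqrt C₀ * W * CFC.sqrt C₀ - (γ₀ / γ₁) • (1 : Matrix ι ι ℝ) := by
      rw [sub_smul, one_smul, hcdef]; abel
    rwa [e]
  have h := ineq2103 hKh hc hc1 hcK hn
  have hcoef : 1 / (2 * ((n : ℝ) + 1) * c) = γ₁ / (2 * ((n : ℝ) + 1) * γ₀) := by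
    rw [hcdef]; field_simp
  simpa only [← trace_pow_eq346 hC₀ W, hcoef] using h

/-! ## §3 (3.19) p. 587: the operator under the second determinant is small -/

omit [Fintype ι] in
/-- p. 586, *"the operators G′_k − H′_k … are positive"*: `G′ ≧ gI` and `H′ ≦ hI` with `h < g` give `G′ − H′ ≻ 0`.
[cite: Balaban1982Higgs2, (3.18) p.586] -/
theorem posDef_sub319 {G H : Matrix ι ι ℝ} {g h : ℝ} (hhg : h < g)
    (hGg : (G - g • (1 : Matrix ι ι ℝ)).PosSemidef) (hHu : (h • (1 : Matrix ι ι ℝ) - H).PosSemidef) : (G - H).PosDef := by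
  have h1 := hGg.add hHu
  have h2 : ((g - h) • (1 : Matrix ι ι ℝ)).PosDef := PosDef.one.smul (by linarith : 0 < g - h)
  have h3 := h2.posSemidef_add h1
  have e : G - g • 1 + (h • 1 - H) + (g - h) • (1 : Matrix ι ι ℝ) = G - H := by rw [sub_smul]; abel
  rwa [e] at h3

/-- **(3.19)** p. 587, the mechanism in Loewner form: `G′ ≻ 0`, `G′ ≧ gI` (`g > 0`, ↤ `½γ₁μ₀⁻²(Lᵏε)²` of (3.11)) and
`−hI ≦ H′ ≦ hI` (`h ≥ 0`, ↤ `‖H′_k‖ ≦ O(1)exp(−δ₁r(Lᵏε))` of (3.12)) give `−(h/g)I ≦ G′^{−1/2}H′G′^{−1/2} ≦ (h/g)I`, i.e.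
`‖G′^{−1/2}H′G′^{−1/2}‖ ≦ g⁻¹h`. [cite: Balaban1982Higgs2, (3.19) p.587] -/
theorem ineq319 {G H : Matrix ι ι ℝ} (hG : G.PosDef) {g h : ℝ} (hg : 0 < g) (hh : 0 ≤ h)
    (hGg : (G - g • (1 : Matrix ι ι ℝ)).PosSemidef) (hHu : (h • (1 : Matrix ι ι ℝ) - H).PosSemidef)
    (hHl : (H + h • (1 : Matrix ι ι ℝ)).PosSemidef) :
    ((h / g) • (1 : Matrix ι ι ℝ) - CFC.sqrt G⁻¹ * H * CFC.sqrt G⁻¹).PosSemidef ∧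
      (CFC.sqrt G⁻¹ * H * CFC.sqrt G⁻¹ + (h / g) • (1 : Matrix ι ι ℝ)).PosSemidef := by
  have hR : (CFC.sqrt G⁻¹)ᴴ = CFC.sqrt G⁻¹ := (isHermitian_sqrt _).eq
  have hinv := (inv_upper hG hg hGg).smul hh        -- h•(g⁻¹I − G⁻¹) ≧ 0
  rw [smul_sub, smul_smul] at hinv
  have hdiv : h * g⁻¹ = h / g := (div_eq_mul_inv h g).symm
  constructor
  · have h1 := hHu.conjTranspose_mul_mul_same (CFC.sqrt G⁻¹)
    rw [hR, Matrix.mul_sub, Matrix.sub_mul, Matrix.mul_smul, Matrix.smul_mul, Matrix.mul_one,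
      sqrt_inv_mul_sqrt_inv hG] at h1
    have h3 := h1.add hinv
    have e : h • G⁻¹ - CFC.sqrt G⁻¹ * H * CFC.sqrt G⁻¹ + ((h * g⁻¹) • (1 : Matrix ι ι ℝ) - h • G⁻¹) =
        (h / g) • (1 : Matrix ι ι ℝ) - CFC.sqrt G⁻¹ * H * CFC.sqrt G⁻¹ := by rw [hdiv]; abel
    rwa [e] at h3
  · have h1 := hHl.conjTranspose_mul_mul_same (CFC.sqrt G⁻¹)
    rw [hR, Matrix.mul_add, Matrix.add_mul, Matrix.mul_smul, Matrix.smul_mul, Matrix.mul_one,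
      sqrt_inv_mul_sqrt_inv hG] at h1
    have h3 := h1.add hinv
    have e : CFC.sqrt G⁻¹ * H * CFC.sqrt G⁻¹ + h • G⁻¹ + ((h * g⁻¹) • (1 : Matrix ι ι ℝ) - h • G⁻¹) =
        CFC.sqrt G⁻¹ * H * CFC.sqrt G⁻¹ + (h / g) • (1 : Matrix ι ι ℝ) := by rw [hdiv]; abel
    rwa [e] at h3

/-! ## §4 (3.20) p. 587 -/

/-- (3.20), second `≦`: for symmetric `K` with `−κI ≦ K ≦ κI` (`‖K‖ ≦ κ`), `Tr K ≦ κ·Tr(I↾Λ)` and `Tr K² ≦ κ²·Tr(I↾Λ)`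
(`Tr(I↾Λ) = |Λ|`). [cite: Balaban1982Higgs2, (3.20) p.587] -/
theorem trace_le320 {K : Matrix ι ι ℝ} (hK : K.IsHermitian) {κ : ℝ}
    (hu : (κ • (1 : Matrix ι ι ℝ) - K).PosSemidef) (hl : (K + κ • (1 : Matrix ι ι ℝ)).PosSemidef) :
    K.trace ≤ κ * Fintype.card ι ∧ (K ^ 2).trace ≤ κ ^ 2 * Fintype.card ι := by
  have hle := eigenvalues_le_of_posSemidef hK hu
  have hl' : (K - (-κ) • (1 : Matrix ι ι ℝ)).PosSemidef := by rwa [neg_smul, sub_neg_eq_add]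
  have hge := le_eigenvalues_of_posSemidef hK hl'
  have htr : K.trace = ∑ i, hK.eigenvalues i := by simpa using hK.trace_eq_sum_eigenvalues
  constructor
  · rw [htr]
    calc ∑ i, hK.eigenvalues i ≤ ∑ _i : ι, κ := sum_le_sum fun i _ => hle i
      _ = κ * Fintype.card ι := by rw [sum_const, card_univ, nsmul_eq_mul, mul_comm]
  · rw [B1Sect3Statements.trace_pow_eq_sum_eigenvalues hK 2]
    calc ∑ i, hK.eigenvalues i ^ 2 ≤ ∑ _i : ι, κ ^ 2 := sum_le_sum fun i _ => sq_le_sq' (hge i) (hle i)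
      _ = κ ^ 2 * Fintype.card ι := by rw [sum_const, card_univ, nsmul_eq_mul, mul_comm]

/-- **(3.20)** p. 587: for symmetric `K` (↤ `G′_k^{−1/2}H′_kG′_k^{−1/2}`) with `‖K‖ ≦ κ ≦ ½` (Loewner `−κI ≦ K ≦ κI`):
`[det(I − K)]^{−1/2} ≦ exp[½Tr K + O(1)Tr K²] ≦ exp[½‖K‖Tr(I↾Λ) + O(1)‖K‖²Tr(I↾Λ)] ≦ exp O(‖K‖)|Λ|` with `O(1) = 1/(4(1−κ))`
(*"an analog of the inequality (2.103)"*: `ineq2103` at `n = 1`, `c = 1 − κ`) and final constant `1`. [cite: Balaban1982Higgs2, (3.20) p.587] -/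
theorem ineq320 {K : Matrix ι ι ℝ} (hK : K.IsHermitian) {κ : ℝ} (hκ : 0 ≤ κ) (hκ2 : κ ≤ 1 / 2)
    (hu : (κ • (1 : Matrix ι ι ℝ) - K).PosSemidef) (hl : (K + κ • (1 : Matrix ι ι ℝ)).PosSemidef) :
    (1 - K).det ^ (-(1 / 2 : ℝ)) ≤ Real.exp ((1 / 2) * K.trace + 1 / (4 * (1 - κ)) * (K ^ 2).trace) ∧
    Real.exp ((1 / 2) * K.trace + 1 / (4 * (1 - κ)) * (K ^ 2).trace) ≤
      Real.exp (((1 / 2) * κ + 1 / (4 * (1 - κ)) * κ ^ 2) * Fintype.card ι) ∧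
    Real.exp (((1 / 2) * κ + 1 / (4 * (1 - κ)) * κ ^ 2) * Fintype.card ι) ≤ Real.exp (κ * Fintype.card ι) := by
  refine ⟨?_, ?_, ?_⟩
  · have hcK : ((1 - (1 - κ)) • (1 : Matrix ι ι ℝ) - K).PosSemidef := by rwa [sub_sub_cancel]
    have h := ineq2103 hK (by linarith : 0 < 1 - κ) (by linarith : 1 - κ ≤ 1) hcK odd_one
    have e : (∑ j ∈ range 1, (1 / (2 * ((j : ℝ) + 1))) * (K ^ (j + 1)).trace) +
        1 / (2 * (((1 : ℕ) : ℝ) + 1) * (1 - κ)) * (K ^ (1 + 1)).trace =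
        (1 / 2) * K.trace + 1 / (4 * (1 - κ)) * (K ^ 2).trace := by
      rw [sum_range_one]; norm_num
    rwa [e] at h
  · obtain ⟨h1, h2⟩ := trace_le320 hK hu hl
    rw [Real.exp_le_exp]
    have hO : 0 ≤ 1 / (4 * (1 - κ)) := by
      have : 0 < 4 * (1 - κ) := by linarith
      positivity
    nlinarith [mul_le_mul_of_nonneg_left h2 hO]
  · rw [Real.exp_le_exp]
    have hN : (0 : ℝ) ≤ Fintype.card ι := Nat.cast_nonneg _
    have hq : 1 / (4 * (1 - κ)) * κ ^ 2 ≤ κ / 2 := by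
      rw [div_mul_eq_mul_div, one_mul, div_le_iff₀ (by linarith)]
      nlinarith
    nlinarith

/-- (3.18)–(3.20) composed (pp. 586–587): for `G′ ≻ 0` with `G′ ≧ gI` (`g > 0`), symmetric `H′` with `−hI ≦ H′ ≦ hI` and
`h/g ≦ ½`: `[det(G′ − H′)]^{−1/2} ≦ (det G′)^{−1/2}·exp((h/g)|Λ|)` — *"the integral (3.9) can be estimated by the same integral with
H′_k = H″_k = 0 … multiplied by the factor exp O((Lᵏε)^κ)|Λ₅^{(k)}|"* for the determinant factors. [cite: Balaban1982Higgs2, (3.18)–(3.20) pp.586–587] -/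
theorem ineq318_320 {G H : Matrix ι ι ℝ} (hG : G.PosDef) (hH : H.IsHermitian) {g h : ℝ} (hg : 0 < g) (hh : 0 ≤ h)
    (hhg : h / g ≤ 1 / 2) (hGg : (G - g • (1 : Matrix ι ι ℝ)).PosSemidef)
    (hHu : (h • (1 : Matrix ι ι ℝ) - H).PosSemidef) (hHl : (H + h • (1 : Matrix ι ι ℝ)).PosSemidef) :
    (G - H).det ^ (-(1 / 2 : ℝ)) ≤ G.det ^ (-(1 / 2 : ℝ)) * Real.exp (h / g * Fintype.card ι) := by
  have hlt : h < g := by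
    have : h / g < 1 := lt_of_le_of_lt hhg (by norm_num)
    rwa [div_lt_one hg] at this
  rw [eq318 hG (posDef_sub319 hlt hGg hHu)]
  refine mul_le_mul_of_nonneg_left ?_ (Real.rpow_nonneg hG.det_pos.le _)
  obtain ⟨hu, hl⟩ := ineq319 hG hg hh hGg hHu hHl
  obtain ⟨h1, h2, h3⟩ := ineq320 (isHermitian_conj hH G) (div_nonneg hh hg.le) hhg hu hl
  exact h1.trans (h2.trans h3)

end Literature.MathematicalPhysics.QuantumFieldTheory.Balaban1983to89.B2Ineq2103LogDet
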